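import Summits.AtomisticToContinuum.FouriersLaw.Theorems.OddSectorIrreversibilityCorrectorTheoryTangentCurrent
import Mathlib.Analysis.Calculus.MeanValue
import Mathlib.Analysis.ODE.Gronwall

/-!
# `HiddenChargeMazur.StaticKubo`, line `birth`, stub `stub_lasotaYorke` — aux 1: deterministic tools

Helper file (`--supports stmt-AtomisticToContinuum-13510`, crux decl `HiddenChargeMazur.StaticKubo`,
skeleton `Cruxes/StaticKubo/Lines/birth.lean` rev 4, stub S5 `stub_lasotaYorke` of the lead).

Elementary facts about the pinned anharmonic chain `pinnedChain ω₂ lam β γ` (`ω₂ > 0`, `lam, β ≥ 0`)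
used by the coupling estimates of the Doeblin–Fortet inequality:

* `abs_fderiv_hamiltonian_le` — `|DH(y)v| ≤ K_H ‖v‖ (1 + H(y))` (linear energy bound of the tree);
* `one_add_hamiltonian_le_mul_exp` — **energy comparison at unit distance**: `1 + H(x+v) ≤ (1+H(x)) e^{K_H}`
  for `‖v‖ ≤ 1` (Grönwall along the segment), and its consequences `hamiltonian_le_of_norm_sub_le_one`,
  `sqrt_hamiltonian_le_of_norm_sub_le_one`;
* `abs_hamiltonian_sub_le` — `|H x − H y| ≤ K_H e^{K_H} (1 + H x) ‖x − y‖` for `‖x−y‖ ≤ 1` (mean value);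
* `abs_cutoff_sub_le` — the energy cutoff `χ_R = max 0 (min 1 (R + 1 − H))` is Lipschitz on unit-close
  pairs with constant `K_H e^{K_H} (R + 2)`;
* `abs_totalBondCurrent_sub_le` — `|J z − J z'| ≤ N(5+13β) e^{2K_H} (1 + H z)² ‖z − z'‖` for `‖z−z'‖ ≤ 1`.

References: folklore (Grönwall, mean value inequality). Nothing here closes the item.
-/

noncomputable section

open MeasureTheory Filter Topology Set Metric
open scoped NNReal ENNReal ContDiff
open Literature.MathematicalPhysics.KineticTheory.HeatConduction Literature.MathematicalPhysics.KineticTheory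
open Literature.Probability.Process OscillatorChain
open Summit.AtomisticToContinuum.FouriersLaw.Theorems.OddSectorIrreversibility.Corrector

namespace Summit.AtomisticToContinuum.FouriersLaw.Cruxes.StaticKubo.Birth.Stubs

variable {N : ℕ}

section Energy

variable {ω₂ lam β : ℝ} (hω : 0 < ω₂) (hl : 0 ≤ lam) (hβ : 0 ≤ β) (γ : ℝ)
include hω hl hβ

/-- **Gradient bound**: `|DH(y)·v| ≤ K_H ‖v‖ (1 + H(y))` with
`K_H = N(ω₂/2 + 3 + lam/ω₂ + N²(3+β)) + N/2 + 1`. [folklore] -/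
theorem abs_fderiv_hamiltonian_le (N : ℕ) (y v : PhaseSpace N) :
    |fderiv ℝ ((pinnedChain ω₂ lam β γ).hamiltonian N) y v| ≤
      (N * (ω₂ / 2 + 3 + lam / ω₂ + N ^ 2 * (3 + β)) + N / 2 + 1) * ‖v‖ *
        (1 + (pinnedChain ω₂ lam β γ).hamiltonian N y) := by
  set P := pinnedChain ω₂ lam β γ with hP
  have hHd : Differentiable ℝ (P.hamiltonian N) :=
    (pinnedChain_contDiff_hamiltonian ω₂ lam β γ N (n := 1)).differentiable one_ne_zero
  have hH0 : 0 ≤ P.hamiltonian N y := pinnedChain_hamiltonian_nonneg hω.le hl hβ γ N y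
  rw [P.fderiv_hamiltonian_apply hHd]
  have h1 : |∑ i, (partialQ i (P.hamiltonian N) y * v.1 i + y.2 i * v.2 i)| ≤
      ∑ i, (|partialQ i (P.hamiltonian N) y| * ‖v‖ + |y.2 i| * ‖v‖) := by
    refine (Finset.abs_sum_le_sum_abs _ _).trans (Finset.sum_le_sum fun i _ => ?_)
    have hv1 : |v.1 i| ≤ ‖v‖ := by
      rw [← Real.norm_eq_abs]
      exact (norm_le_pi_norm v.1 i).trans (norm_fst_le v)
    have hv2 : |v.2 i| ≤ ‖v‖ := by
      rw [← Real.norm_eq_abs]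
      exact (norm_le_pi_norm v.2 i).trans (norm_snd_le v)
    calc |partialQ i (P.hamiltonian N) y * v.1 i + y.2 i * v.2 i|
        ≤ |partialQ i (P.hamiltonian N) y * v.1 i| + |y.2 i * v.2 i| := abs_add_le _ _
      _ = |partialQ i (P.hamiltonian N) y| * |v.1 i| + |y.2 i| * |v.2 i| := by rw [abs_mul, abs_mul]
      _ ≤ _ := add_le_add (mul_le_mul_of_nonneg_left hv1 (abs_nonneg _))
          (mul_le_mul_of_nonneg_left hv2 (abs_nonneg _))
  refine h1.trans ?_
  rw [Finset.sum_add_distrib, ← Finset.sum_mul, ← Finset.sum_mul]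
  have hq := pinnedChain_sum_abs_partialQ_le hω hl hβ γ N y
  have hp := pinnedChain_sum_abs_momentum_le hω.le hl hβ γ N y
  have hv : 0 ≤ ‖v‖ := norm_nonneg _
  have hc0 : 0 ≤ (N : ℝ) * (ω₂ / 2 + 3 + lam / ω₂ + N ^ 2 * (3 + β)) := by
    have : 0 ≤ lam / ω₂ := div_nonneg hl hω.le
    positivity
  calc (∑ i, |partialQ i (P.hamiltonian N) y|) * ‖v‖ + (∑ i, |y.2 i|) * ‖v‖
      ≤ (N * (ω₂ / 2 + 3 + lam / ω₂ + N ^ 2 * (3 + β)) * (1 + P.hamiltonian N y)) * ‖v‖ +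
          (N / 2 + P.hamiltonian N y) * ‖v‖ :=
        add_le_add (mul_le_mul_of_nonneg_right hq hv) (mul_le_mul_of_nonneg_right hp hv)
    _ ≤ _ := by nlinarith [mul_nonneg hv hH0, mul_nonneg (Nat.cast_nonneg N) (mul_nonneg hv hH0)]

/-- **Energy comparison at unit distance**: `1 + H(x + v) ≤ (1 + H(x)) e^{K_H}` for `‖v‖ ≤ 1`
(Grönwall along `s ↦ x + s v`: the derivative of `1 + H` is at most `K_H (1 + H)`). [folklore] -/
theorem one_add_hamiltonian_le_mul_exp (N : ℕ) (x v : PhaseSpace N) (hv : ‖v‖ ≤ 1) :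
    1 + (pinnedChain ω₂ lam β γ).hamiltonian N (x + v) ≤
      (1 + (pinnedChain ω₂ lam β γ).hamiltonian N x) *
        Real.exp (N * (ω₂ / 2 + 3 + lam / ω₂ + N ^ 2 * (3 + β)) + N / 2 + 1) := by
  set P := pinnedChain ω₂ lam β γ with hP
  set K : ℝ := N * (ω₂ / 2 + 3 + lam / ω₂ + N ^ 2 * (3 + β)) + N / 2 + 1 with hK
  have hHd : Differentiable ℝ (P.hamiltonian N) :=
    (pinnedChain_contDiff_hamiltonian ω₂ lam β γ N (n := 1)).differentiable one_ne_zero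
  -- the scalar function along the segment
  set g : ℝ → ℝ := fun s => 1 + P.hamiltonian N (x + s • v) with hg
  have hpath : ∀ s : ℝ, HasDerivAt (fun s : ℝ => x + s • v) v s := fun s => by
    simpa using ((hasDerivAt_id s).smul_const v).const_add x
  have hg' : ∀ s : ℝ, HasDerivAt g (fderiv ℝ (P.hamiltonian N) (x + s • v) v) s := fun s => by
    have h := ((hHd (x + s • v)).hasFDerivAt).comp_hasDerivAt s (hpath s)
    exact h.const_add 1
  have hgpos : ∀ s, 0 < g s := fun s => by
    have := pinnedChain_hamiltonian_nonneg hω.le hl hβ γ N (x + s • v)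
    simp only [hg]; linarith
  have hbound : ∀ s ∈ Ico (0 : ℝ) 1, ‖fderiv ℝ (P.hamiltonian N) (x + s • v) v‖ ≤ K * ‖g s‖ + 0 := by
    intro s _
    rw [add_zero, Real.norm_eq_abs, Real.norm_eq_abs, abs_of_pos (hgpos s)]
    have h := abs_fderiv_hamiltonian_le hω hl hβ γ N (x + s • v) v
    have hg0 : 0 ≤ 1 + P.hamiltonian N (x + s • v) := (hgpos s).le
    have hK0 : 0 ≤ K := by
      have : 0 ≤ lam / ω₂ := div_nonneg hl hω.le
      positivity
    calc |fderiv ℝ (P.hamiltonian N) (x + s • v) v| ≤ K * ‖v‖ * (1 + P.hamiltonian N (x + s • v)) := h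
      _ ≤ K * 1 * (1 + P.hamiltonian N (x + s • v)) := by gcongr
      _ = K * g s := by rw [mul_one]
  have hcont : ContinuousOn g (Icc (0 : ℝ) 1) := fun s _ => (hg' s).continuousAt.continuousWithinAt
  have hderiv : ∀ s ∈ Ico (0 : ℝ) 1, HasDerivWithinAt g (fderiv ℝ (P.hamiltonian N) (x + s • v) v) (Ici s) s :=
    fun s _ => (hg' s).hasDerivWithinAt
  have hinit : ‖g 0‖ ≤ 1 + P.hamiltonian N x := by
    rw [Real.norm_eq_abs, abs_of_pos (hgpos 0)]
    simp [hg]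
  have h := norm_le_gronwallBound_of_norm_deriv_right_le hcont hderiv hinit hbound 1
    ⟨zero_le_one, le_rfl⟩
  rw [gronwallBound_ε0, sub_zero, mul_one, Real.norm_eq_abs, abs_of_pos (hgpos 1)] at h
  simpa [hg] using h

/-- `1 + H(y) ≤ e^{K_H} (1 + H(x))` whenever `‖x − y‖ ≤ 1`. [folklore] -/
theorem hamiltonian_le_of_norm_sub_le_one (N : ℕ) (x y : PhaseSpace N) (hxy : ‖x - y‖ ≤ 1) :
    1 + (pinnedChain ω₂ lam β γ).hamiltonian N y ≤
      Real.exp (N * (ω₂ / 2 + 3 + lam / ω₂ + N ^ 2 * (3 + β)) + N / 2 + 1) *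
        (1 + (pinnedChain ω₂ lam β γ).hamiltonian N x) := by
  have hv : ‖y - x‖ ≤ 1 := by rwa [norm_sub_rev]
  have h := one_add_hamiltonian_le_mul_exp hω hl hβ γ N x (y - x) hv
  rw [add_sub_cancel] at h
  linarith [mul_comm (1 + (pinnedChain ω₂ lam β γ).hamiltonian N x)
    (Real.exp (N * (ω₂ / 2 + 3 + lam / ω₂ + N ^ 2 * (3 + β)) + N / 2 + 1))]

/-- `√H(y) ≤ e^{K_H/2} (1 + √H(x))` whenever `‖x − y‖ ≤ 1`. [folklore] -/
theorem sqrt_hamiltonian_le_of_norm_sub_le_one (N : ℕ) (x y : PhaseSpace N) (hxy : ‖x - y‖ ≤ 1) :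
    Real.sqrt ((pinnedChain ω₂ lam β γ).hamiltonian N y) ≤
      Real.exp ((N * (ω₂ / 2 + 3 + lam / ω₂ + N ^ 2 * (3 + β)) + N / 2 + 1) / 2) *
        (1 + Real.sqrt ((pinnedChain ω₂ lam β γ).hamiltonian N x)) := by
  set K : ℝ := N * (ω₂ / 2 + 3 + lam / ω₂ + N ^ 2 * (3 + β)) + N / 2 + 1 with hK
  have h := hamiltonian_le_of_norm_sub_le_one hω hl hβ γ N x y hxy
  have hHx : 0 ≤ (pinnedChain ω₂ lam β γ).hamiltonian N x := pinnedChain_hamiltonian_nonneg hω.le hl hβ γ N x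
  have h1 : Real.sqrt ((pinnedChain ω₂ lam β γ).hamiltonian N y) ≤
      Real.sqrt (Real.exp K * (1 + (pinnedChain ω₂ lam β γ).hamiltonian N x)) :=
    Real.sqrt_le_sqrt (by linarith)
  refine h1.trans ?_
  rw [Real.sqrt_mul (Real.exp_pos K).le, show Real.exp K = Real.exp (K / 2) * Real.exp (K / 2) by
    rw [← Real.exp_add]; ring_nf, Real.sqrt_mul_self (Real.exp_pos _).le]
  refine mul_le_mul_of_nonneg_left ?_ (Real.exp_pos _).le
  rw [Real.sqrt_le_left (by positivity)]
  nlinarith [Real.sq_sqrt hHx, Real.sqrt_nonneg ((pinnedChain ω₂ lam β γ).hamiltonian N x)]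

/-- Operator-norm form of the gradient bound: `‖DH(z)‖ ≤ K_H (1 + H(z))`. [folklore] -/
theorem norm_fderiv_hamiltonian_le (N : ℕ) (z : PhaseSpace N) :
    ‖fderiv ℝ ((pinnedChain ω₂ lam β γ).hamiltonian N) z‖ ≤
      (N * (ω₂ / 2 + 3 + lam / ω₂ + N ^ 2 * (3 + β)) + N / 2 + 1) *
        (1 + (pinnedChain ω₂ lam β γ).hamiltonian N z) := by
  have hH0 : 0 ≤ (pinnedChain ω₂ lam β γ).hamiltonian N z := pinnedChain_hamiltonian_nonneg hω.le hl hβ γ N z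
  have hK0 : 0 ≤ (N * (ω₂ / 2 + 3 + lam / ω₂ + N ^ 2 * (3 + β)) + N / 2 + 1) := by
    have : 0 ≤ lam / ω₂ := div_nonneg hl hω.le
    positivity
  refine ContinuousLinearMap.opNorm_le_bound _ (by positivity) fun v => ?_
  rw [Real.norm_eq_abs]
  have := abs_fderiv_hamiltonian_le hω hl hβ γ N z v
  calc _ ≤ _ := this
    _ = _ := by ring

/-- **`H` is Lipschitz on unit-close pairs with an energy weight**:
`|H x − H y| ≤ K_H e^{K_H} (1 + H x) ‖x − y‖` for `‖x − y‖ ≤ 1` (mean value inequality on the closed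
unit ball around `x`, where `1 + H ≤ e^{K_H}(1 + H x)`). [folklore] -/
theorem abs_hamiltonian_sub_le (N : ℕ) (x y : PhaseSpace N) (hxy : ‖x - y‖ ≤ 1) :
    |(pinnedChain ω₂ lam β γ).hamiltonian N x - (pinnedChain ω₂ lam β γ).hamiltonian N y| ≤
      (N * (ω₂ / 2 + 3 + lam / ω₂ + N ^ 2 * (3 + β)) + N / 2 + 1) *
        Real.exp (N * (ω₂ / 2 + 3 + lam / ω₂ + N ^ 2 * (3 + β)) + N / 2 + 1) *
        (1 + (pinnedChain ω₂ lam β γ).hamiltonian N x) * ‖x - y‖ := by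
  set P := pinnedChain ω₂ lam β γ with hP
  set K : ℝ := N * (ω₂ / 2 + 3 + lam / ω₂ + N ^ 2 * (3 + β)) + N / 2 + 1 with hK
  have hK0 : 0 ≤ K := by
    have : 0 ≤ lam / ω₂ := div_nonneg hl hω.le
    positivity
  have hHd : Differentiable ℝ (P.hamiltonian N) :=
    (pinnedChain_contDiff_hamiltonian ω₂ lam β γ N (n := 1)).differentiable one_ne_zero
  have hHx : 0 ≤ P.hamiltonian N x := pinnedChain_hamiltonian_nonneg hω.le hl hβ γ N x
  -- bound of the derivative on the closed unit ball around `x`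
  have hball : ∀ z ∈ closedBall x 1, ‖fderiv ℝ (P.hamiltonian N) z‖ ≤ K * Real.exp K * (1 + P.hamiltonian N x) := by
    intro z hz
    rw [mem_closedBall, dist_eq_norm, norm_sub_rev] at hz
    have h1 := norm_fderiv_hamiltonian_le hω hl hβ γ N z
    have h3 : 1 + P.hamiltonian N z ≤ Real.exp K * (1 + P.hamiltonian N x) :=
      hamiltonian_le_of_norm_sub_le_one hω hl hβ γ N x z hz
    calc ‖fderiv ℝ (P.hamiltonian N) z‖ ≤ K * (1 + P.hamiltonian N z) := h1
      _ ≤ K * (Real.exp K * (1 + P.hamiltonian N x)) := mul_le_mul_of_nonneg_left h3 hK0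
      _ = _ := by ring
  have hmv := (convex_closedBall x 1).norm_image_sub_le_of_norm_fderiv_le
    (fun z _ => hHd z) hball (mem_closedBall_self zero_le_one)
    (show y ∈ closedBall x 1 by rwa [mem_closedBall, dist_eq_norm, norm_sub_rev])
  rw [Real.norm_eq_abs, abs_sub_comm] at hmv
  calc |P.hamiltonian N x - P.hamiltonian N y| ≤ K * Real.exp K * (1 + P.hamiltonian N x) * ‖y - x‖ := hmv
    _ = _ := by rw [norm_sub_rev]

/-- **The energy cutoff is Lipschitz on unit-close pairs**: for `χ_R = max 0 (min 1 (R + 1 − H))`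
(`= 1` on `{H ≤ R}`, `= 0` on `{H ≥ R + 1}`, values in `[0,1]`) and `R ≥ 0`,
`|χ_R z − χ_R z'| ≤ K_H e^{K_H} (R + 2) ‖z − z'‖` whenever `‖z − z'‖ ≤ 1`. [folklore] -/
theorem abs_cutoff_sub_le (N : ℕ) {R : ℝ} (hR : 0 ≤ R) (z z' : PhaseSpace N) (hzz : ‖z - z'‖ ≤ 1) :
    |max 0 (min 1 (R + 1 - (pinnedChain ω₂ lam β γ).hamiltonian N z)) -
        max 0 (min 1 (R + 1 - (pinnedChain ω₂ lam β γ).hamiltonian N z'))| ≤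
      (N * (ω₂ / 2 + 3 + lam / ω₂ + N ^ 2 * (3 + β)) + N / 2 + 1) *
        Real.exp (N * (ω₂ / 2 + 3 + lam / ω₂ + N ^ 2 * (3 + β)) + N / 2 + 1) * (R + 2) * ‖z - z'‖ := by
  set P := pinnedChain ω₂ lam β γ with hP
  set K : ℝ := N * (ω₂ / 2 + 3 + lam / ω₂ + N ^ 2 * (3 + β)) + N / 2 + 1 with hK
  have hK0 : 0 ≤ K := by
    have : 0 ≤ lam / ω₂ := div_nonneg hl hω.le
    positivity
  have hcoef : 0 ≤ K * Real.exp K * (R + 2) * ‖z - z'‖ := by positivity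
  -- the max/min cutoff is 1-Lipschitz in the energy
  have hlip : ∀ a b : ℝ, |max 0 (min 1 (R + 1 - a)) - max 0 (min 1 (R + 1 - b))| ≤ |a - b| := by
    intro a b
    calc |max 0 (min 1 (R + 1 - a)) - max 0 (min 1 (R + 1 - b))|
        ≤ max |(0 : ℝ) - 0| |min 1 (R + 1 - a) - min 1 (R + 1 - b)| := abs_max_sub_max_le_max _ _ _ _
      _ = |min 1 (R + 1 - a) - min 1 (R + 1 - b)| := by simp [abs_nonneg]
      _ ≤ max |(1 : ℝ) - 1| |(R + 1 - a) - (R + 1 - b)| := abs_min_sub_min_le_max _ _ _ _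
      _ = |(R + 1 - a) - (R + 1 - b)| := by simp [abs_nonneg]
      _ = |a - b| := by rw [show (R + 1 - a) - (R + 1 - b) = -(a - b) by ring, abs_neg]
  -- both far above the cutoff: both values vanish
  by_cases hfar : R + 1 ≤ P.hamiltonian N z ∧ R + 1 ≤ P.hamiltonian N z'
  · have h1 : max 0 (min 1 (R + 1 - P.hamiltonian N z)) = 0 :=
      max_eq_left ((min_le_right _ _).trans (by linarith [hfar.1]))
    have h2 : max 0 (min 1 (R + 1 - P.hamiltonian N z')) = 0 :=
      max_eq_left ((min_le_right _ _).trans (by linarith [hfar.2]))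
    rw [h1, h2, sub_zero, abs_zero]
    exact hcoef
  · rw [not_and_or, not_le, not_le] at hfar
    rcases hfar with hz | hz'
    · -- `H z < R + 1`
      have h := abs_hamiltonian_sub_le hω hl hβ γ N z z' hzz
      refine (hlip _ _).trans (h.trans ?_)
      have : 1 + P.hamiltonian N z ≤ R + 2 := by linarith
      gcongr
    · -- `H z' < R + 1`
      have hzz' : ‖z' - z‖ ≤ 1 := by rwa [norm_sub_rev]
      have h := abs_hamiltonian_sub_le hω hl hβ γ N z' z hzz'
      rw [abs_sub_comm] at h
      refine (hlip _ _).trans (h.trans ?_)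
      rw [norm_sub_rev]
      have : 1 + P.hamiltonian N z' ≤ R + 2 := by linarith
      gcongr

/-- **The total current is Lipschitz on unit-close pairs with a polynomial energy weight**:
`|J z − J z'| ≤ N(5 + 13β) e^{2K_H} (1 + H z)² ‖z − z'‖` for `‖z − z'‖ ≤ 1`
(`‖Dj_i‖ ≤ (5+13β)(1+H)²` of the tree and the mean value inequality on the closed unit ball).
[folklore] -/
theorem abs_totalBondCurrent_sub_le (N : ℕ) (z z' : PhaseSpace N) (hzz : ‖z - z'‖ ≤ 1) :
    |(∑ i : Fin N, (pinnedChain ω₂ lam β γ).bondCurrent N i z) -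
        ∑ i : Fin N, (pinnedChain ω₂ lam β γ).bondCurrent N i z'| ≤
      N * (5 + 13 * β) * Real.exp (2 * (N * (ω₂ / 2 + 3 + lam / ω₂ + N ^ 2 * (3 + β)) + N / 2 + 1)) *
        (1 + (pinnedChain ω₂ lam β γ).hamiltonian N z) ^ 2 * ‖z - z'‖ := by
  set P := pinnedChain ω₂ lam β γ with hP
  set K : ℝ := N * (ω₂ / 2 + 3 + lam / ω₂ + N ^ 2 * (3 + β)) + N / 2 + 1 with hK
  have hK0 : 0 ≤ K := by
    have : 0 ≤ lam / ω₂ := div_nonneg hl hω.le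
    positivity
  have hHz : 0 ≤ P.hamiltonian N z := pinnedChain_hamiltonian_nonneg hω.le hl hβ γ N z
  have hV : ContDiff ℝ ∞ P.V := pinnedChain_contDiff_V ω₂ lam β γ
  have hJi : ∀ i : Fin N, Differentiable ℝ fun x : PhaseSpace N => P.bondCurrent N i x := fun i =>
    (contDiff_bondCurrent P hV N i).differentiable (by simp)
  have hJd : Differentiable ℝ fun x : PhaseSpace N => ∑ i : Fin N, P.bondCurrent N i x :=
    Differentiable.fun_sum fun i _ => hJi i
  -- derivative bound on the closed unit ball around `z`
  have hball : ∀ w ∈ closedBall z 1, ‖fderiv ℝ (fun x : PhaseSpace N => ∑ i : Fin N, P.bondCurrent N i x) w‖ ≤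
      N * (5 + 13 * β) * Real.exp (2 * K) * (1 + P.hamiltonian N z) ^ 2 := by
    intro w hw
    rw [mem_closedBall, dist_eq_norm, norm_sub_rev] at hw
    have hsum : fderiv ℝ (fun x : PhaseSpace N => ∑ i : Fin N, P.bondCurrent N i x) w =
        ∑ i : Fin N, fderiv ℝ (fun x : PhaseSpace N => P.bondCurrent N i x) w :=
      fderiv_fun_sum fun i _ => hJi i w
    rw [hsum]
    have h3 : (1 + P.hamiltonian N w) ^ 2 ≤ (Real.exp K * (1 + P.hamiltonian N z)) ^ 2 := by
      have hw0 : 0 ≤ 1 + P.hamiltonian N w := by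
        linarith [pinnedChain_hamiltonian_nonneg hω.le hl hβ γ N w]
      exact pow_le_pow_left₀ hw0 (hamiltonian_le_of_norm_sub_le_one hω hl hβ γ N z w hw) 2
    calc ‖∑ i : Fin N, fderiv ℝ (fun x : PhaseSpace N => P.bondCurrent N i x) w‖
        ≤ ∑ i : Fin N, ‖fderiv ℝ (fun x : PhaseSpace N => P.bondCurrent N i x) w‖ := norm_sum_le _ _
      _ ≤ ∑ _i : Fin N, (5 + 13 * β) * (1 + P.hamiltonian N w) ^ 2 :=
          Finset.sum_le_sum fun i _ =>
            norm_fderiv_bondCurrent_le hω.le hl hβ γ N i w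
      _ = N * ((5 + 13 * β) * (1 + P.hamiltonian N w) ^ 2) := by
          rw [Finset.sum_const, Finset.card_univ, Fintype.card_fin, nsmul_eq_mul]
      _ ≤ N * ((5 + 13 * β) * (Real.exp K * (1 + P.hamiltonian N z)) ^ 2) := by gcongr
      _ = N * (5 + 13 * β) * Real.exp (2 * K) * (1 + P.hamiltonian N z) ^ 2 := by
          rw [mul_pow, ← Real.exp_nat_mul]; push_cast; ring
  have hmv := (convex_closedBall z 1).norm_image_sub_le_of_norm_fderiv_le
    (fun w _ => hJd w) hball (mem_closedBall_self zero_le_one)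
    (show z' ∈ closedBall z 1 by rwa [mem_closedBall, dist_eq_norm, norm_sub_rev])
  rw [Real.norm_eq_abs, abs_sub_comm, norm_sub_rev] at hmv
  exact hmv

end Energy

/-! ### Elementary real inequalities -/

/-- `√h ≤ η h + 1/(4η)` for `h ≥ 0`, `η > 0`. [folklore] -/
theorem sqrt_le_mul_add_inv {h η : ℝ} (hh : 0 ≤ h) (hη : 0 < η) : Real.sqrt h ≤ η * h + 1 / (4 * η) := by
  have hs := Real.sq_sqrt hh
  have h4 : 0 < 4 * η := by positivity
  rw [← sub_nonneg]
  have : η * h + 1 / (4 * η) - Real.sqrt h = (2 * η * Real.sqrt h - 1) ^ 2 / (4 * η) := by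
    field_simp
    nlinarith [hs]
  rw [this]
  positivity

/-- `b √h ≤ ε h + b²/(4ε)` for `h ≥ 0`, `ε > 0`. [folklore] -/
theorem mul_sqrt_le {b h ε : ℝ} (hh : 0 ≤ h) (hε : 0 < ε) : b * Real.sqrt h ≤ ε * h + b ^ 2 / (4 * ε) := by
  have hs := Real.sq_sqrt hh
  rw [← sub_nonneg]
  have : ε * h + b ^ 2 / (4 * ε) - b * Real.sqrt h = (2 * ε * Real.sqrt h - b) ^ 2 / (4 * ε) := by
    field_simp
    nlinarith [hs]
  rw [this]
  positivity

/-- `exp(a + b√h) ≤ exp(a + b²/(4ε)) · exp(ε h)` for `h ≥ 0`, `ε > 0`. [folklore] -/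
theorem exp_add_mul_sqrt_le {a b h ε : ℝ} (hh : 0 ≤ h) (hε : 0 < ε) :
    Real.exp (a + b * Real.sqrt h) ≤ Real.exp (a + b ^ 2 / (4 * ε)) * Real.exp (ε * h) := by
  rw [← Real.exp_add]
  exact Real.exp_le_exp.2 (by linarith [mul_sqrt_le (b := b) hh hε])

/-- `(1 + h)² ≤ ε⁻² exp(2εh)` for `h ≥ 0`, `0 < ε ≤ 1`. [folklore] -/
theorem one_add_sq_le_exp {h ε : ℝ} (hh : 0 ≤ h) (hε : 0 < ε) (hε1 : ε ≤ 1) :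
    (1 + h) ^ 2 ≤ (1 / ε) ^ 2 * Real.exp (2 * ε * h) := by
  have h1 : ε * (1 + h) ≤ Real.exp (ε * h) := by
    have := Real.add_one_le_exp (ε * h)
    nlinarith
  have h2 : 1 + h ≤ 1 / ε * Real.exp (ε * h) := by
    rw [div_mul_eq_mul_div, le_div_iff₀ hε, one_mul]; linarith
  calc (1 + h) ^ 2 ≤ (1 / ε * Real.exp (ε * h)) ^ 2 := pow_le_pow_left₀ (by linarith) h2 2
    _ = (1 / ε) ^ 2 * Real.exp (2 * ε * h) := by
        rw [mul_pow, ← Real.exp_nat_mul]; push_cast; ring_nf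

/-- **Threshold lemma**: `C exp(A + B√h − c h^{3/4}) ≤ 1/2` for all large `h` (`c > 0`): the exponent
`A + √h (B − c h^{1/4})` tends to `−∞`. [folklore] -/
theorem exists_threshold (A B C c : ℝ) (hc : 0 < c) :
    ∃ E₀ : ℝ, 0 ≤ E₀ ∧ ∀ h : ℝ, E₀ ≤ h →
      C * Real.exp (A + B * Real.sqrt h - c * h ^ (3 / 4 : ℝ)) ≤ 1 / 2 := by
  -- the exponent tends to `-∞`
  have h14 : Tendsto (fun h : ℝ => h ^ (1 / 4 : ℝ)) atTop atTop := tendsto_rpow_atTop (by norm_num)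
  have h12 : Tendsto (fun h : ℝ => h ^ (1 / 2 : ℝ)) atTop atTop := tendsto_rpow_atTop (by norm_num)
  have hlin : Tendsto (fun h : ℝ => B - c * h ^ (1 / 4 : ℝ)) atTop atBot := by
    have h1 : Tendsto (fun h : ℝ => c * h ^ (1 / 4 : ℝ)) atTop atTop := h14.const_mul_atTop hc
    have h2 : Tendsto (fun h : ℝ => -(c * h ^ (1 / 4 : ℝ))) atTop atBot := tendsto_neg_atTop_atBot.comp h1
    simpa [sub_eq_add_neg] using tendsto_atBot_add_const_left atTop B h2
  have hprod : Tendsto (fun h : ℝ => h ^ (1 / 2 : ℝ) * (B - c * h ^ (1 / 4 : ℝ))) atTop atBot :=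
    h12.atTop_mul_atBot₀ hlin
  have hexp : Tendsto (fun h : ℝ => A + B * Real.sqrt h - c * h ^ (3 / 4 : ℝ)) atTop atBot := by
    have h1 : Tendsto (fun h : ℝ => A + h ^ (1 / 2 : ℝ) * (B - c * h ^ (1 / 4 : ℝ))) atTop atBot :=
      tendsto_atBot_add_const_left atTop A hprod
    refine h1.congr' ?_
    filter_upwards [eventually_ge_atTop 0] with h hh
    rw [Real.sqrt_eq_rpow, show (3 / 4 : ℝ) = 1 / 2 + 1 / 4 by norm_num,
      Real.rpow_add' hh (by norm_num)]
    ring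
  have hlim : Tendsto (fun h : ℝ => C * Real.exp (A + B * Real.sqrt h - c * h ^ (3 / 4 : ℝ))) atTop (𝓝 0) := by
    have := (Real.tendsto_exp_atBot.comp hexp).const_mul C
    simpa using this
  have hev : ∀ᶠ h : ℝ in atTop, C * Real.exp (A + B * Real.sqrt h - c * h ^ (3 / 4 : ℝ)) < 1 / 2 :=
    (tendsto_order.1 hlim).2 _ (by norm_num)
  obtain ⟨E, hE⟩ := Filter.eventually_atTop.1 hev
  exact ⟨max E 0, le_max_right _ _, fun h hh => (hE h ((le_max_left _ _).trans hh)).le⟩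

/-- **Registered form of this file's principal estimate** (`stub_lasotaYorke_aux1`, closed statement of
`abs_totalBondCurrent_sub_le`): the total current is Lipschitz on unit-close pairs with a polynomial
energy weight. [folklore] -/
theorem stub_lasotaYorke_aux1 :
    ∀ ω₂ lam β γ : ℝ, 0 < ω₂ → 0 ≤ lam → 0 ≤ β → ∀ (N : ℕ) (z z' : PhaseSpace N), ‖z - z'‖ ≤ 1 → |(∑ i : Fin N, (pinnedChain ω₂ lam β γ).bondCurrent N i z) - ∑ i : Fin N, (pinnedChain ω₂ lam β γ).bondCurrent N i z'| ≤ N * (5 + 13 * β) * Real.exp (2 * (N * (ω₂ / 2 + 3 + lam / ω₂ + N ^ 2 * (3 + β)) + N / 2 + 1)) * (1 + (pinnedChain ω₂ lam β γ).hamiltonian N z) ^ 2 * ‖z - z'‖ :=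
  fun _ _ _ γ hω hl hβ N z z' hzz => abs_totalBondCurrent_sub_le hω hl hβ γ N z z' hzz

end Summit.AtomisticToContinuum.FouriersLaw.Cruxes.StaticKubo.Birth.Stubs

end
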